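import Literature.MathematicalPhysics.KineticTheory.TrigPolyLocality
import Literature.MathematicalPhysics.KineticTheory.PhaseSpacePoissonLie
import HarnessLib

/-!
# Symbolic truncated series of trigonometric polynomials and what they represent

`Literature/MathematicalPhysics/KineticTheory/` — the symbolic counterpart of
`Literature/Algebra/Lie/TruncatedLieSeries.lean` for the class `𝒮(Ω)` of W. De Roeck, F. Huveneers,
CPAM 68 (2015), arXiv:1305.5127, §3: a symbolic truncated series is a sequence `S : ℕ → TrigPoly m`
of symbolic trigonometric polynomials (component `j` = coefficient of `ε^j`), and it REPRESENTS a
truncated series `F : TruncSeries (SmoothFun m) n` of smooth functions at scale `δ` when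
`(F_j)(z) = ev (S j) δ z` for `j ≤ n` (`SymSeries.Represents`).

The symbolic operations mirror the semantic ones coefficient by coefficient and preserve
representation (all proved): sums (`Represents.add`), the truncated bracket
(`SymSeries.bracketTS`, `Represents.bracketTS`), iterated brackets with a generator
(`SymSeries.adPow`, `Represents.adPow`), the canonical transformations `e^{ε^p ad u}`
(`SymSeries.expOp`, `Represents.expOp`, via the coefficient formula `TruncSeries.expOp_coeff`; and
`SymSeries.expOpD`/`Represents.expOpD`, the variant in which the first bracket with the order-`0`
component is given by a prescribed representative — the homological equation of the scheme),
their composites `Q`, `R` (`SymSeries.qOp/rOp`, `Represents.qOp/rOp`) and the evaluation at `ε`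
(`SymSeries.eval`, `Represents.val_eval`). Locality radii are tracked explicitly
(`SymSeries.Good n r δ`: every component `j ≤ n` is local within `r` and smooth at `δ`;
`adPow` has radius `r + 2 i r_U`, `expOp` radius `r + 2 n r_U`, `qRad`/`rRad` for the composites).
No named facts.
-/

noncomputable section

open Function Set Finset Filter
open scoped ContDiff BigOperators Topology

namespace Literature.MathematicalPhysics.KineticTheory.HeatConduction

open Literature.Algebra.Lie Literature.Algebra.Lie.TruncSeries

variable {m : ℕ}

/-- List sums over `List.range` are `Finset.range` sums. [folklore] -/
theorem list_sum_map_range {M : Type*} [AddCommMonoid M] (f : ℕ → M) (n : ℕ) :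
    ((List.range n).map f).sum = ∑ i ∈ Finset.range n, f i := by
  induction n with
  | zero => simp
  | succ n ih => rw [List.range_succ, List.map_append, List.sum_append, ih, Finset.sum_range_succ]; simp

/-- A symbolic truncated series: component `j` is the (symbolic) coefficient of `ε^j`.
[cite: DeRoeckHuveneers2015, §3.1 (formal power series in `ε`)] -/
abbrev SymSeries (m : ℕ) : Type := ℕ → TrigPoly m

namespace SymSeries

/-! ### Operations -/

/-- Sum, componentwise concatenation. [folklore] -/
def add (S S' : SymSeries m) : SymSeries m := fun j => S j ++ S' j

/-- Componentwise negation. [folklore] -/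
def neg (S : SymSeries m) : SymSeries m := fun j => TrigPoly.neg (S j)

/-- Componentwise functional multiple. [folklore] -/
def smulFun (θ : ℝ → (Fin m → ℝ) → ℝ) (S : SymSeries m) : SymSeries m := fun j => TrigPoly.smulFun θ (S j)

/-- The truncated bracket `(S * S')_j = ∑_{i ≤ j} {S_i, S'_{j-i}}` (radii `r`, `r'` for the filter).
[cite: DeRoeckHuveneers2015, §3.3] -/
def bracketTS (r r' : ℕ) (S S' : SymSeries m) : SymSeries m := fun j =>
  (List.range (j + 1)).flatMap fun i => TrigPoly.bracket r r' (S i) (S' (j - i))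

/-- Iterated bracket with a generator `U` of radius `rU`: `ad_U^i F`, the radius after `i` steps being
`r + 2 i rU`. [cite: DeRoeckHuveneers2015, §3.3 ("`L_U^k`")] -/
def adPow (rU : ℕ) (U : TrigPoly m) : ℕ → ℕ → TrigPoly m → TrigPoly m
  | 0, _, F => F
  | i + 1, r, F => TrigPoly.bracket rU (r + 2 * i * rU) U (adPow rU U i r F)

/-- The symbolic `e^{ε^p ad_U}` truncated at order `n`:
`(e^{ε^p ad_U} S)_j = ∑_{i ≤ n, ip ≤ j} ad_U^i S_{j - ip} / i!`. [cite: DeRoeckHuveneers2015, §3.3] -/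
def expOp (n p rU : ℕ) (U : TrigPoly m) (rS : ℕ) (S : SymSeries m) : SymSeries m := fun j =>
  (List.range (n + 1)).flatMap fun i =>
    if i * p ≤ j then
      (if i = 0 then S j else TrigPoly.constSMul ((i.factorial : ℝ)⁻¹) (adPow rU U i rS (S (j - i * p))))
    else []

/-- The symbolic `e^{ε^p ad_U}` with the SHARP action on the order-`0` component: when `ad_U^i` hits
`S_0` (`i p = j`), the first bracket `{U, S_0}` is replaced by a given symbolic representative `UD`
(for the perturbative scheme: `S_0 = D` and `{U^{(k)}, D} = -(Id - 𝓡)P_k` by the homological equation,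
which is how `S^{(k)} D ∼ δ^{-2k}` is obtained in the proof of (3.14)). [cite: DeRoeckHuveneers2015, §3.3 proof of (3.14)] -/
def expOpD (n p rU : ℕ) (U UD : TrigPoly m) (rS : ℕ) (S : SymSeries m) : SymSeries m := fun j =>
  (List.range (n + 1)).flatMap fun i =>
    if i * p ≤ j then
      (if i = 0 then S j
        else if i * p = j then TrigPoly.constSMul ((i.factorial : ℝ)⁻¹) (adPow rU U (i - 1) rU UD)
        else TrigPoly.constSMul ((i.factorial : ℝ)⁻¹) (adPow rU U i rS (S (j - i * p))))
    else []

/-- Below order `p` the symbolic `e^{ε^p ad_U}` changes nothing, literally. [folklore] -/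
theorem expOp_apply_of_lt {n p rU : ℕ} (U : TrigPoly m) (rS : ℕ) (S : SymSeries m) {j : ℕ} (hj : j < p) :
    expOp n p rU U rS S j = S j := by
  unfold expOp
  rw [List.range_succ_eq_map, List.flatMap_cons]
  simp only [zero_mul, zero_le, if_true]
  rw [List.flatMap_map]
  simp only [List.append_right_eq_self, List.flatMap_eq_nil_iff, ite_eq_right_iff]
  intro x _ hx
  exfalso
  have := Nat.le_mul_of_pos_left p (Nat.succ_pos x)
  omega

/-- Below order `p` the sharp symbolic `e^{ε^p ad_U}` changes nothing, literally. [folklore] -/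
theorem expOpD_apply_of_lt {n p rU : ℕ} (U UD : TrigPoly m) (rS : ℕ) (S : SymSeries m) {j : ℕ} (hj : j < p) :
    expOpD n p rU U UD rS S j = S j := by
  unfold expOpD
  rw [List.range_succ_eq_map, List.flatMap_cons]
  simp only [zero_mul, zero_le, if_true]
  rw [List.flatMap_map]
  simp only [List.append_right_eq_self, List.flatMap_eq_nil_iff, ite_eq_right_iff]
  intro x _ hx
  exfalso
  have := Nat.le_mul_of_pos_left p (Nat.succ_pos x)
  omega

/-- The evaluation `∑_{j ≤ n} ε^j S_j` as one symbolic polynomial. [cite: DeRoeckHuveneers2015, §3.1 eq. (3.5)] -/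
def eval (n : ℕ) (ε : ℝ) (S : SymSeries m) : TrigPoly m :=
  (List.range (n + 1)).flatMap fun j => TrigPoly.constSMul (ε ^ j) (S j)

/-- Radius after `k` stages of `Q`: `qRad 0 = r₀`, `qRad (k+1) = qRad k + 2 n rU(k+1)`. [folklore] -/
def qRad (n : ℕ) (rU : ℕ → ℕ) (r₀ : ℕ) : ℕ → ℕ
  | 0 => r₀
  | k + 1 => qRad n rU r₀ k + 2 * n * rU (k + 1)

/-- The symbolic `Q_k = e^{ε^k ad U_k} ∘ ⋯ ∘ e^{ε ad U_1}` (radii `rU k` of the generators, `r₀` of the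
input). [cite: DeRoeckHuveneers2015, §3.3] -/
def qOp (n : ℕ) (U : ℕ → TrigPoly m) (rU : ℕ → ℕ) (r₀ : ℕ) (S : SymSeries m) : ℕ → SymSeries m
  | 0 => S
  | k + 1 => expOp n (k + 1) (rU (k + 1)) (U (k + 1)) (qRad n rU r₀ k) (qOp n U rU r₀ S k)

/-- The symbolic `R_k = e^{-ε ad U_1} ∘ ⋯ ∘ e^{-ε^k ad U_k}` applied to an input of radius `r`.
[cite: DeRoeckHuveneers2015, §3.3] -/
def rOp (n : ℕ) (U : ℕ → TrigPoly m) (rU : ℕ → ℕ) : ℕ → ℕ → SymSeries m → SymSeries m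
  | 0, _, S => S
  | k + 1, r, S => rOp n U rU k (r + 2 * n * rU (k + 1)) (expOp n (k + 1) (rU (k + 1)) (TrigPoly.neg (U (k + 1))) r S)

/-- Radius of the output of `R_k` on an input of radius `r`. [folklore] -/
def rRad (n : ℕ) (rU : ℕ → ℕ) : ℕ → ℕ → ℕ
  | 0, r => r
  | k + 1, r => rRad n rU k (r + 2 * n * rU (k + 1))

/-! ### Goodness (locality + smoothness) of all components -/

/-- Every component `j ≤ n` is local within `r` and smooth at scale `δ`. [folklore] -/
def Good (S : SymSeries m) (n r : ℕ) (δ : ℝ) : Prop := ∀ j ≤ n, (S j).Good r δ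

variable {n : ℕ} {δ : ℝ}

/-- Monotonicity in the radius. [folklore] -/
theorem Good.mono {S : SymSeries m} {r : ℕ} (h : S.Good n r δ) {r' : ℕ} (hr : r ≤ r') : S.Good n r' δ :=
  fun j hj => (h j hj).mono hr

/-- Sums of good series are good. [folklore] -/
theorem Good.add {S S' : SymSeries m} {r : ℕ} (h : S.Good n r δ) (h' : S'.Good n r δ) : (add S S').Good n r δ :=
  fun j hj => (h j hj).append (h' j hj)

/-- Negation keeps goodness. [folklore] -/
theorem Good.neg {S : SymSeries m} {r : ℕ} (h : S.Good n r δ) : (neg S).Good n r δ :=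
  fun j hj => (h j hj).neg

/-- Iterated brackets: radius `r + 2 i rU`. [cite: DeRoeckHuveneers2015, §3.3] -/
theorem good_adPow {rU : ℕ} {U : TrigPoly m} (hU : U.Good rU δ) :
    ∀ (i : ℕ) {r : ℕ} {F : TrigPoly m}, F.Good r δ → (adPow rU U i r F).Good (r + 2 * i * rU) δ := by
  intro i
  induction i with
  | zero => intro r F hF; simpa [adPow] using hF
  | succ i ih =>
    intro r F hF
    have h := hU.bracket (ih hF)
    simp only [adPow]
    refine h.mono ?_
    ring_nf; omega

/-- `e^{ε^p ad_U}` keeps goodness with radius `rS + 2 n rU`. [cite: DeRoeckHuveneers2015, §3.3] -/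
theorem Good.expOp {rU : ℕ} {U : TrigPoly m} (hU : U.Good rU δ) (p : ℕ) {rS : ℕ} {S : SymSeries m}
    (hS : S.Good n rS δ) : (expOp n p rU U rS S).Good n (rS + 2 * n * rU) δ := by
  intro j hj
  refine TrigPoly.good_flatMap fun i hi => ?_
  have hin : i ≤ n := Nat.lt_succ_iff.1 (List.mem_range.1 hi)
  by_cases h : i * p ≤ j
  · rw [if_pos h]
    by_cases hi0 : i = 0
    · rw [if_pos hi0]
      exact (hS j hj).mono (by nlinarith)
    · rw [if_neg hi0]
      have hg := good_adPow hU i (hS (j - i * p) (le_trans (Nat.sub_le _ _) hj))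
      exact (hg.constSMul _).mono (by nlinarith)
  · rw [if_neg h]
    exact TrigPoly.good_nil _ _

/-- The sharp `e^{ε^p ad_U}` keeps goodness with radius `rS + 2 n rU` (`UD` of radius `rU`, `rU ≤ rS`).
[cite: DeRoeckHuveneers2015, §3.3] -/
theorem Good.expOpD {rU : ℕ} {U UD : TrigPoly m} (hU : U.Good rU δ) (hUD : UD.Good rU δ) {rS' : ℕ} (hr : rU ≤ rS')
    (p : ℕ) {S : SymSeries m} (hS : S.Good n rS' δ) : (expOpD n p rU U UD rS' S).Good n (rS' + 2 * n * rU) δ := by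
  intro j hj
  refine TrigPoly.good_flatMap fun i hi => ?_
  have hin : i ≤ n := Nat.lt_succ_iff.1 (List.mem_range.1 hi)
  by_cases h : i * p ≤ j
  · rw [if_pos h]
    by_cases hi0 : i = 0
    · rw [if_pos hi0]
      exact (hS j hj).mono (by nlinarith)
    · rw [if_neg hi0]
      by_cases hij : i * p = j
      · rw [if_pos hij]
        have hg := good_adPow hU (i - 1) hUD
        refine (hg.constSMul _).mono ?_
        have : (i - 1) * rU ≤ n * rU := Nat.mul_le_mul_right rU (by omega)
        nlinarith
      · rw [if_neg hij]
        have hg := good_adPow hU i (hS (j - i * p) (le_trans (Nat.sub_le _ _) hj))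
        exact (hg.constSMul _).mono (by nlinarith)
  · rw [if_neg h]
    exact TrigPoly.good_nil _ _

/-- The truncated bracket of good series is good with radius `r' + 2r`. [cite: DeRoeckHuveneers2015, §3.3] -/
theorem Good.bracketTS {S S' : SymSeries m} {r r' : ℕ} (hS : S.Good n r δ) (hS' : S'.Good n r' δ) :
    (bracketTS r r' S S').Good n (r' + 2 * r) δ := by
  intro j hj
  refine TrigPoly.good_flatMap fun i hi => ?_
  have hij : i ≤ j := Nat.lt_succ_iff.1 (List.mem_range.1 hi)
  exact (hS i (hij.trans hj)).bracket (hS' (j - i) (le_trans (Nat.sub_le _ _) hj))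

/-- Evaluation at `ε` of a good series is good. [folklore] -/
theorem Good.eval {S : SymSeries m} {r : ℕ} (hS : S.Good n r δ) (ε : ℝ) : (eval n ε S).Good r δ :=
  TrigPoly.good_flatMap fun j hj => (hS j (Nat.lt_succ_iff.1 (List.mem_range.1 hj))).constSMul _

/-- `Q_k` keeps goodness with radius `qRad k`. [cite: DeRoeckHuveneers2015, §3.3 (3.11)] -/
theorem Good.qOp {U : ℕ → TrigPoly m} {rU : ℕ → ℕ} (hU : ∀ k, 1 ≤ k → (U k).Good (rU k) δ) {r₀ : ℕ}
    {S : SymSeries m} (hS : S.Good n r₀ δ) : ∀ k, (qOp n U rU r₀ S k).Good n (qRad n rU r₀ k) δ := by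
  intro k
  induction k with
  | zero => exact hS
  | succ k ih => exact (ih.expOp (hU (k + 1) (Nat.succ_pos k)) (k + 1))

/-- `R_k` keeps goodness with radius `rRad k r`. [cite: DeRoeckHuveneers2015, §3.3 (3.11)] -/
theorem Good.rOp {U : ℕ → TrigPoly m} {rU : ℕ → ℕ} (hU : ∀ k, 1 ≤ k → (U k).Good (rU k) δ) :
    ∀ (k : ℕ) {r : ℕ} {S : SymSeries m}, S.Good n r δ → (rOp n U rU k r S).Good n (rRad n rU k r) δ := by
  intro k
  induction k with
  | zero => intro r S hS; exact hS
  | succ k ih =>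
    intro r S hS
    exact ih (hS.expOp (hU (k + 1) (Nat.succ_pos k)).neg (k + 1))

/-! ### Representation of semantic truncated series -/

/-- `S` represents `F` at scale `δ`: `F_j = ev (S j) δ` for `j ≤ n`. [folklore] -/
def Represents (δ : ℝ) (n : ℕ) (S : SymSeries m) (F : TruncSeries (SmoothFun m) n) : Prop :=
  ∀ j ≤ n, (F.coeff j).val = TrigPoly.ev (S j) δ

variable {S S' : SymSeries m} {F F' : TruncSeries (SmoothFun m) n}

/-- Sums. [folklore] -/
theorem Represents.add (h : Represents δ n S F) (h' : Represents δ n S' F') :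
    Represents δ n (add S S') (F + F') := by
  intro j hj
  funext z
  rw [TruncSeries.coeff_add, SmoothFun.val_add, Pi.add_apply, h j hj, h' j hj]
  simp [SymSeries.add]

/-- Negation. [folklore] -/
theorem Represents.neg (h : Represents δ n S F) : Represents δ n (neg S) (-F) := by
  intro j hj
  funext z
  rw [TruncSeries.coeff_neg, SmoothFun.val_neg, Pi.neg_apply, h j hj]
  simp [SymSeries.neg]

/-- Real multiples of a component. [folklore] -/
theorem val_smul_eq_ev_constSMul {G : SmoothFun m} {P : TrigPoly m} (h : G.val = TrigPoly.ev P δ) (c : ℝ) :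
    (c • G).val = TrigPoly.ev (TrigPoly.constSMul c P) δ := by
  funext z
  rw [SmoothFun.val_smul, Pi.smul_apply, h, smul_eq_mul, TrigPoly.ev_constSMul]

/-- **The truncated bracket** is represented by the symbolic truncated bracket (good inputs).
[cite: DeRoeckHuveneers2015, §3.3] -/
theorem Represents.bracketTS {r r' : ℕ} (hS : S.Good n r δ) (hS' : S'.Good n r' δ) (h : Represents δ n S F)
    (h' : Represents δ n S' F') : Represents δ n (bracketTS r r' S S') (F * F') := by
  intro j hj
  funext z
  rw [TruncSeries.coeff_mul_of_le _ _ hj, SmoothFun.val_sum]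
  simp only [SmoothFun.val_lie]
  rw [Finset.Nat.sum_antidiagonal_eq_sum_range_succ_mk]
  simp only [SymSeries.bracketTS, TrigPoly.ev_flatMap, list_sum_map_range]
  refine sum_congr rfl fun i hi => ?_
  have hij : i ≤ j := Nat.lt_succ_iff.1 (mem_range.1 hi)
  rw [h i (hij.trans hj), h' (j - i) (le_trans (Nat.sub_le _ _) hj)]
  exact (hS i (hij.trans hj)).poisson_ev_ev (hS' (j - i) (le_trans (Nat.sub_le _ _) hj)) z

/-- **Iterated brackets**: `ad_u^i G` is represented by `adPow U i` when `u` is represented by `U`.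
[cite: DeRoeckHuveneers2015, §3.3] -/
theorem Represents.adPow {rU : ℕ} {U : TrigPoly m} (hU : U.Good rU δ) {u : SmoothFun m}
    (hu : u.val = TrigPoly.ev U δ) :
    ∀ (i : ℕ) {r : ℕ} {P : TrigPoly m} {G : SmoothFun m}, P.Good r δ → G.val = TrigPoly.ev P δ →
      ((fun x : SmoothFun m => ⁅u, x⁆)^[i] G).val = TrigPoly.ev (adPow rU U i r P) δ := by
  intro i
  induction i with
  | zero => intro r P G _ hG; simpa [SymSeries.adPow] using hG
  | succ i ih =>
    intro r P G hP hG
    rw [Function.iterate_succ_apply', SmoothFun.val_lie, ih hP hG, hu]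
    funext z
    simp only [SymSeries.adPow]
    exact hU.poisson_ev_ev (good_adPow hU i hP) z

/-- **`e^{ε^p ad u}` is represented by the symbolic `expOp`** (`p ≥ 1`, good inputs).
[cite: DeRoeckHuveneers2015, §3.3] -/
theorem Represents.expOp {p : ℕ} (hp : 1 ≤ p) {rU : ℕ} {U : TrigPoly m} (hU : U.Good rU δ) {u : SmoothFun m}
    (hu : u.val = TrigPoly.ev U δ) {rS : ℕ} (hS : S.Good n rS δ) (h : Represents δ n S F) :
    Represents δ n (expOp n p rU U rS S) (TruncSeries.expOp p u F) := by
  intro j hj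
  funext z
  have hc := TruncSeries.expOp_coeff hp u F hj
  -- value of the semantic coefficient at `z`
  have hval : (TruncSeries.expOp p u F).coeff j =
      ∑ i ∈ range (n + 1), (if i * p ≤ j then ((i.factorial : ℝ)⁻¹) •
        (fun x : SmoothFun m => ⁅u, x⁆)^[i] (F.coeff (j - i * p)) else 0) := hc
  rw [hval, SmoothFun.val_sum]
  simp only [SymSeries.expOp, TrigPoly.ev_flatMap, list_sum_map_range]
  refine sum_congr rfl fun i _ => ?_
  by_cases hi : i * p ≤ j
  · rw [if_pos hi, if_pos hi, SmoothFun.val_smul, Pi.smul_apply, smul_eq_mul]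
    by_cases hi0 : i = 0
    · subst hi0
      simp only [if_true, Nat.factorial_zero, Nat.cast_one, inv_one, one_mul, Function.iterate_zero, id_eq,
        zero_mul, Nat.sub_zero]
      rw [h j hj]
    · rw [if_neg hi0, TrigPoly.ev_constSMul,
        Represents.adPow hU hu i (hS (j - i * p) (le_trans (Nat.sub_le _ _) hj))
          (h (j - i * p) (le_trans (Nat.sub_le _ _) hj))]
  · rw [if_neg hi, if_neg hi, SmoothFun.val_zero, Pi.zero_apply, TrigPoly.ev_nil]

/-- **The sharp `e^{ε^p ad u}` is represented by `expOpD`** when `UD` represents `⁅u, F_0⁆`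
(`p ≥ 1`, good inputs). [cite: DeRoeckHuveneers2015, §3.3] -/
theorem Represents.expOpD {p : ℕ} (hp : 1 ≤ p) {rU : ℕ} {U UD : TrigPoly m} (hU : U.Good rU δ) (hUD : UD.Good rU δ)
    {u : SmoothFun m} (hu : u.val = TrigPoly.ev U δ) (huD : (⁅u, F.coeff 0⁆ : SmoothFun m).val = TrigPoly.ev UD δ)
    {rS : ℕ} (hS : S.Good n rS δ) (h : Represents δ n S F) :
    Represents δ n (expOpD n p rU U UD rS S) (TruncSeries.expOp p u F) := by
  intro j hj
  funext z
  have hval : (TruncSeries.expOp p u F).coeff j =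
      ∑ i ∈ range (n + 1), (if i * p ≤ j then ((i.factorial : ℝ)⁻¹) •
        (fun x : SmoothFun m => ⁅u, x⁆)^[i] (F.coeff (j - i * p)) else 0) := TruncSeries.expOp_coeff hp u F hj
  rw [hval, SmoothFun.val_sum]
  simp only [SymSeries.expOpD, TrigPoly.ev_flatMap, list_sum_map_range]
  refine sum_congr rfl fun i _ => ?_
  by_cases hi : i * p ≤ j
  · rw [if_pos hi, if_pos hi, SmoothFun.val_smul, Pi.smul_apply, smul_eq_mul]
    by_cases hi0 : i = 0
    · subst hi0
      simp only [if_true, Nat.factorial_zero, Nat.cast_one, inv_one, one_mul, Function.iterate_zero, id_eq,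
        zero_mul, Nat.sub_zero]
      rw [h j hj]
    · rw [if_neg hi0]
      by_cases hij : i * p = j
      · rw [if_pos hij, TrigPoly.ev_constSMul]
        have hj0 : j - i * p = 0 := by omega
        obtain ⟨i', rfl⟩ : ∃ i', i = i' + 1 := ⟨i - 1, by omega⟩
        rw [hj0, Function.iterate_succ_apply, Nat.add_sub_cancel,
          Represents.adPow hU hu i' hUD huD]
      · rw [if_neg hij, TrigPoly.ev_constSMul,
          Represents.adPow hU hu i (hS (j - i * p) (le_trans (Nat.sub_le _ _) hj))
            (h (j - i * p) (le_trans (Nat.sub_le _ _) hj))]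
  · rw [if_neg hi, if_neg hi, SmoothFun.val_zero, Pi.zero_apply, TrigPoly.ev_nil]

/-- **`Q_k` is represented by the symbolic `qOp`** (generators `u k` represented by `U k`, all good).
[cite: DeRoeckHuveneers2015, §3.3] -/
theorem Represents.qOp {U : ℕ → TrigPoly m} {rU : ℕ → ℕ} (hU : ∀ k, 1 ≤ k → (U k).Good (rU k) δ)
    {u : ℕ → SmoothFun m} (hu : ∀ k, 1 ≤ k → (u k).val = TrigPoly.ev (U k) δ) {r₀ : ℕ} (hS : S.Good n r₀ δ)
    (h : Represents δ n S F) : ∀ k, Represents δ n (qOp n U rU r₀ S k) (TruncSeries.qOp u k F) := by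
  intro k
  induction k with
  | zero => exact h
  | succ k ih =>
    rw [TruncSeries.qOp_succ]
    exact ih.expOp (Nat.succ_pos k) (hU _ (Nat.succ_pos k)) (hu _ (Nat.succ_pos k)) (hS.qOp hU k)

/-- **`R_k` is represented by the symbolic `rOp`.** [cite: DeRoeckHuveneers2015, §3.3] -/
theorem Represents.rOp {U : ℕ → TrigPoly m} {rU : ℕ → ℕ} (hU : ∀ k, 1 ≤ k → (U k).Good (rU k) δ)
    {u : ℕ → SmoothFun m} (hu : ∀ k, 1 ≤ k → (u k).val = TrigPoly.ev (U k) δ) :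
    ∀ (k : ℕ) {r : ℕ} {S : SymSeries m} {F : TruncSeries (SmoothFun m) n}, S.Good n r δ → Represents δ n S F →
      Represents δ n (rOp n U rU k r S) (TruncSeries.rOp u k F) := by
  intro k
  induction k with
  | zero => intro r S F _ h; exact h
  | succ k ih =>
    intro r S F hS h
    rw [TruncSeries.rOp_succ]
    refine ih (hS.expOp (hU _ (Nat.succ_pos k)).neg (k + 1)) ?_
    have hneg : (-u (k + 1)).val = TrigPoly.ev (TrigPoly.neg (U (k + 1))) δ := by
      funext z; rw [SmoothFun.val_neg, Pi.neg_apply, hu _ (Nat.succ_pos k), TrigPoly.ev_neg]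
    exact h.expOp (Nat.succ_pos k) (hU _ (Nat.succ_pos k)).neg hneg hS

/-- **Evaluation at `ε`**: `ev_ε F = ∑ ε^j F_j` is represented by `eval n ε S`. [cite: DeRoeckHuveneers2015, §3.1 (3.5)] -/
theorem Represents.val_eval (h : Represents δ n S F) (ε : ℝ) (z : PhaseSpace m) :
    (TruncSeries.eval ε F).val z = TrigPoly.ev (eval n ε S) δ z := by
  rw [SmoothFun.val_eval]
  simp only [SymSeries.eval, TrigPoly.ev_flatMap, list_sum_map_range, TrigPoly.ev_constSMul]
  refine sum_congr rfl fun j hj => ?_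
  rw [h j (Nat.lt_succ_iff.1 (mem_range.1 hj))]

/-- Replacing one component by a symbolically different but equally evaluating polynomial keeps
representation. [folklore] -/
theorem Represents.update (h : Represents δ n S F) (k : ℕ) {P : TrigPoly m}
    (hP : k ≤ n → TrigPoly.ev P δ = TrigPoly.ev (S k) δ) : Represents δ n (Function.update S k P) F := by
  intro j hj
  by_cases hjk : j = k
  · subst hjk; rw [Function.update_self, hP hj]; exact h j hj
  · rw [Function.update_of_ne hjk]; exact h j hj

/-- Goodness after replacing one component by a good polynomial. [folklore] -/
theorem Good.update {r : ℕ} (hS : S.Good n r δ) (k : ℕ) {P : TrigPoly m} (hP : P.Good r δ) :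
    Good (Function.update S k P) n r δ := by
  intro j hj
  by_cases hjk : j = k
  · subst hjk; rw [Function.update_self]; exact hP
  · rw [Function.update_of_ne hjk]; exact hS j hj

end SymSeries

end Literature.MathematicalPhysics.KineticTheory.HeatConduction

end
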